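/-
Copyright (c) 2026 the pub-hodgecm-mathlib formalisation cell (harness21).  Prover seat hodgecm-mathlib-K2E1-p09 (g4), Track B ∕ K2-LIT,
h413 = `stmt-HodgeConjecture-24833`, line `K2_E1_TraceFormulaBeta`, campaign RES-RANK-ONE, brick (H2): F3-c and the density (H2)-f SPECIALISED to `U(Φ₂)`, `U(Φ₃)`
(sequel of ★ p857132 `K2E1PseudoEisensteinDischargeU`).  DEAL of the dealer K2E1-plan (g2) 2026-09-04T03:29:15Z ∕ 03:44:10Z.
-/
import Summits.HodgeConjecture.HodgeConjecture.Theorems.K2E1PseudoEisensteinDischargeU            -- ★ p857132 (this seat): unimodular radicals, Weil `μ_N`, F2b∕F3 at `U(Φ_N)`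
import Summits.HodgeConjecture.HodgeConjecture.Theorems.K2E1PseudoEisensteinCuspidalCriterionL2   -- ★ (K2E1-p02 g5): F3-c `…_sq` and (H2)-f `…_of_cocompact`, generic
import HarnessLib

/-!
# h413 ∕ Track B «K2-LIT», campaign RES-RANK-ONE, brick (H2) — helper `K2E1PseudoEisensteinDensityU`:
# `(L²_cusp(U(Φ_N)))ᗮ = closure (span {[θ_Φ]})` for `N = 2, 3`, with NO residual hypothesis

Cell `pub/hodgecm-mathlib`, crux H413 = `stmt-HodgeConjecture-24833`, route `HCCMUnconditional`; chair K2-lead (g0), dealer K2E1-plan (g2).  THEOREMS ONLY (no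
`def`, no `instance`, no `notation`, no named-fact hypothesis, no `sorry`); lane `--kind proof --supports stmt-HodgeConjecture-24833 --as helper` (count-neutral).

★ (K2E1-p02 (g5)) `K2E1PseudoEisensteinCuspidalCriterionL2` proves, for a generic adelic datum with `A_G = 1`, per radical `N_i`: F3-c
`constantTermVanishes_of_forall_pseudoEisenstein_sq` (a CONTINUOUS `ψ` orthogonal to the SQUARE-INTEGRABLE pseudo-Eisenstein series has vanishing constant terms) and
(H2)-f `cuspidalSubspace_orthogonal_eq_topologicalClosure_span_of_cocompact` (`(L²_cusp)ᗮ = closure (span Θ)`), under the per-radical data (`N_i(𝔸)` closed, `N_i(K)`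
co-compact, inversion-invariant Haar `ν_N` with a fundamental domain, invariant `μ_N` finite on compacta and positive on opens, `G(K)` discrete).  ★ p857132
`K2E1PseudoEisensteinDischargeU` supplies ALL these data for `𝒢 = cmDatum L N Φ_N` at `𝔓 = cmParabolicData L 2` ∕ `cmParabolicDataR L 3`.  Here the two are put together:
* **`constantTermVanishes_cmParabolicData_two∕R_three_of_forall_pseudoEisenstein_sq`**, **`mem_cmCuspForms_two∕R_three_of_forall_pseudoEisenstein_sq`** — F3-c at `U(Φ₂)`,
  `U(Φ₃)`: a continuous square-integrable `ψ` orthogonal to every SQUARE-INTEGRABLE `θ_Φ` is a cusp form (test class `𝒯_i` = Borel right-`N_i(𝔸)`-invariant `Φ` with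
  `∫⁻ θ_{‖Φ‖}² dμ < ∞`, non-empty by ★ `K2E1PseudoEisensteinBounded`);
* **`cmCuspidalSubspace_orthogonal_eq_topologicalClosure_span_two`** ∕ **`cmCuspidalSubspaceR_orthogonal_eq_topologicalClosure_span_three`** — THE DENSITY:
  `(L²_cusp(U(Φ_N)))ᗮ` is the closure of the span of the classes `[θ_Φ]`, `Φ ∈ 𝒯_i` (the set `Θ` written with an explicit `MemLp` witness so that the statement carries no
  instance; it is ★ p02's `Θ` by proof irrelevance).
Nothing but an automorphic `μ` and the ambient Borel structure on `U(Φ_N)(𝔸_{L⁺})` is assumed.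

HONEST LABEL.  Count-neutral helper; proves no printed statement; HC_CM is proved only modulo the 7 printed citations (2 remaining named inputs: hLiu418 =
`stmt-HodgeConjecture-24832`, h413 = `stmt-HodgeConjecture-24833`) until rung 0 closes.

## References
* [MoeglinWaldspurger1995] C. Mœglin, J.-L. Waldspurger, *Spectral decomposition and Eisenstein series* (1995), II.1.1–II.1.4, I.2.6.
* [Garrett2018] P. Garrett, *Modern Analysis of Automorphic Forms by Example* 1 (2018), §1.8–1.9.
* [BorelJacquet1979] A. Borel, H. Jacquet, *Automorphic forms and automorphic representations*, PSPM 33.1 (1979), §4.4–4.6.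
-/

set_option autoImplicit false
set_option linter.dupNamespace false  -- the mandated namespace repeats the summit's segment (`HodgeConjecture.HodgeConjecture`)

noncomputable section
open MeasureTheory Measure Set Filter Topology NumberField
open Literature.MeasureTheory.Group Literature.NumberTheory.Automorphic Literature.NumberTheory.Automorphic.UnitaryGroup AdelicGroupData
open Summit.HodgeConjecture.HodgeConjecture.Cruxes.H413.K2E1CuspidalSpectrumUnitary
open Summit.HodgeConjecture.HodgeConjecture.Cruxes.H413.K2E1SiegelRadicalCocompactU2 (exists_isCompact_rational_smul_mem_siegel)
open Summit.HodgeConjecture.HodgeConjecture.Cruxes.H413.K2E1HeisenbergRadicalCocompactU3 (exists_isCompact_rational_smul_mem_heisenberg)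
open Summit.HodgeConjecture.HodgeConjecture.Cruxes.H413.K2E1BorelLeviU (isClosed_cmParabolicData_radical_two isClosed_cmParabolicDataR_radical_three)
open Summit.HodgeConjecture.HodgeConjecture.Cruxes.H413.K2E1BorelLeviUDomains (exists_isFundamentalDomain_cmParabolicData_two exists_isFundamentalDomain_cmParabolicDataR_three)
open Summit.HodgeConjecture.HodgeConjecture.Cruxes.H413.K2E1PseudoEisensteinCuspOrthogonal (memLp_two_pseudoEisenstein_automorphicQuotient)
open Summit.HodgeConjecture.HodgeConjecture.Cruxes.H413.K2E1PseudoEisensteinCuspidalCriterionL2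
  (constantTermVanishes_of_forall_pseudoEisenstein_sq cuspidalSubspace_orthogonal_eq_topologicalClosure_span_of_cocompact)
open Summit.HodgeConjecture.HodgeConjecture.Cruxes.H413.K2E1PseudoEisensteinDischargeU
open scoped ENNReal NNReal Pointwise ComplexConjugate

namespace Summit.HodgeConjecture.HodgeConjecture.Cruxes.H413.K2E1PseudoEisensteinDensityU

variable (L : Type) [Field L] [NumberField L] [IsCMField L]

/-! ## `U(Φ₂)` (Siegel radical, `𝔓 = cmParabolicData L 2`) -/

section DensityTwo
variable [MeasurableSpace (cmDatum L 2 (Matrix.of fun i j : Fin 2 => if i.val + j.val + 1 = 2 then (1 : L) else 0)).Adelic] [BorelSpace (cmDatum L 2 (Matrix.of fun i j : Fin 2 => if i.val + j.val + 1 = 2 then (1 : L) else 0)).Adelic]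
  (μ : Measure (cmDatum L 2 (Matrix.of fun i j : Fin 2 => if i.val + j.val + 1 = 2 then (1 : L) else 0)).automorphicQuotient) [(cmDatum L 2 (Matrix.of fun i j : Fin 2 => if i.val + j.val + 1 = 2 then (1 : L) else 0)).IsAutomorphicMeasure μ]

/-- **F3-c FOR `U(Φ₂)`, UNCONDITIONAL**: for an automorphic `μ` on `X = U(Φ₂)(L⁺)\U(Φ₂)(𝔸_{L⁺})`, a CONTINUOUS `ψ : X → ℂ` and an index `i`, if `∫_X θ_Φ · conj ψ dμ = 0` for
every Borel right-`N_i(𝔸)`-invariant `Φ` with `∫⁻_X θ_{‖Φ‖}² dμ < ∞` (the SQUARE-INTEGRABLE test class `𝒯_i`), then ★ `ConstantTermVanishes (cmParabolicData L 2) ψ i` — ★ (p02 g5)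
`constantTermVanishes_of_forall_pseudoEisenstein_sq` with all per-radical data supplied by ★ p857132 (`exists_invariantMeasure_quotient_cmParabolicData_two`, `isInvInvariant_cmParabolicData_two`, ★ `exists_isCompact_rational_smul_mem_siegel`).
[cite: MoeglinWaldspurger1995, II.1.3] [cite: BorelJacquet1979, §4.4] -/
theorem constantTermVanishes_cmParabolicData_two_of_forall_pseudoEisenstein_sq (i : (cmParabolicData L 2).ι)
    {ψ : (cmDatum L 2 (Matrix.of fun i j : Fin 2 => if i.val + j.val + 1 = 2 then (1 : L) else 0)).automorphicQuotient → ℂ} (hψ : Continuous ψ)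
    (horth : ∀ Φ : (cmDatum L 2 (Matrix.of fun i j : Fin 2 => if i.val + j.val + 1 = 2 then (1 : L) else 0)).Adelic → ℂ, Measurable Φ →
      (∀ (g : (cmDatum L 2 (Matrix.of fun i j : Fin 2 => if i.val + j.val + 1 = 2 then (1 : L) else 0)).Adelic) (n : (cmParabolicData L 2).radical i), Φ (g * n) = Φ g) →
      ∫⁻ x, (∑' q : (cmDatum L 2 (Matrix.of fun i j : Fin 2 => if i.val + j.val + 1 = 2 then (1 : L) else 0)).quotientSubgroup ⧸
          ((cmParabolicData L 2).radical i).subgroupOf (cmDatum L 2 (Matrix.of fun i j : Fin 2 => if i.val + j.val + 1 = 2 then (1 : L) else 0)).quotientSubgroup,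
            ‖Φ ((Quotient.out x : (cmDatum L 2 (Matrix.of fun i j : Fin 2 => if i.val + j.val + 1 = 2 then (1 : L) else 0)).Adelic) *
              (q.out : (cmDatum L 2 (Matrix.of fun i j : Fin 2 => if i.val + j.val + 1 = 2 then (1 : L) else 0)).Adelic))‖ₑ) ^ 2 ∂μ < ∞ →
      ∫ x, (∑' q : (cmDatum L 2 (Matrix.of fun i j : Fin 2 => if i.val + j.val + 1 = 2 then (1 : L) else 0)).quotientSubgroup ⧸
          ((cmParabolicData L 2).radical i).subgroupOf (cmDatum L 2 (Matrix.of fun i j : Fin 2 => if i.val + j.val + 1 = 2 then (1 : L) else 0)).quotientSubgroup,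
            Φ ((Quotient.out x : (cmDatum L 2 (Matrix.of fun i j : Fin 2 => if i.val + j.val + 1 = 2 then (1 : L) else 0)).Adelic) *
              (q.out : (cmDatum L 2 (Matrix.of fun i j : Fin 2 => if i.val + j.val + 1 = 2 then (1 : L) else 0)).Adelic))) * conj (ψ x) ∂μ = 0) :
    AdelicGroupData.ConstantTermVanishes (cmParabolicData L 2) ψ i := by
  haveI := discreteTopology_cmDatum_quotientSubgroup L 2 (Matrix.of fun i j : Fin 2 => if i.val + j.val + 1 = 2 then (1 : L) else 0)
  haveI : IsClosed (((cmParabolicData L 2).radical i : Subgroup (cmDatum L 2 (Matrix.of fun i j : Fin 2 => if i.val + j.val + 1 = 2 then (1 : L) else 0)).Adelic) :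
      Set (cmDatum L 2 (Matrix.of fun i j : Fin 2 => if i.val + j.val + 1 = 2 then (1 : L) else 0)).Adelic) := isClosed_cmParabolicData_radical_two L i
  haveI : LocallyCompactSpace ((cmParabolicData L 2).radical i) := (isClosed_cmParabolicData_radical_two L i).locallyCompactSpace
  letI : MeasurableSpace ((cmDatum L 2 (Matrix.of fun i j : Fin 2 => if i.val + j.val + 1 = 2 then (1 : L) else 0)).Adelic ⧸ (cmParabolicData L 2).radical i) := borel _
  haveI : BorelSpace ((cmDatum L 2 (Matrix.of fun i j : Fin 2 => if i.val + j.val + 1 = 2 then (1 : L) else 0)).Adelic ⧸ (cmParabolicData L 2).radical i) := ⟨rfl⟩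
  obtain ⟨μN, hμN, hμNc, hμNo⟩ := exists_invariantMeasure_quotient_cmParabolicData_two L i
  haveI := hμN; haveI := hμNc; haveI := hμNo
  have hcpt : ∃ C : Set ((cmParabolicData L 2).radical i), IsCompact C ∧ ∀ u : (cmParabolicData L 2).radical i, ∃ l : (cmParabolicData L 2).rational i, l • u ∈ C := by
    obtain ⟨k, hk⟩ := i
    obtain rfl : k = 1 := by omega
    exact exists_isCompact_rational_smul_mem_siegel L (antidiagOne_eq_over (L := L) (N := 2)).symm
  have hQ : (cmDatum L 2 (Matrix.of fun i j : Fin 2 => if i.val + j.val + 1 = 2 then (1 : L) else 0)).quotientSubgroup =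
      (cmDatum L 2 (Matrix.of fun i j : Fin 2 => if i.val + j.val + 1 = 2 then (1 : L) else 0)).arithmeticSubgroup :=
    (cmDatum_quotientSubgroup L 2 _).trans (cmDatum_arithmeticSubgroup L 2 _).symm
  -- ★ F3-c at the subtype Borel structure and `ν_N := haar` (explicit mode: the conclusion is itself a `∀ [MeasurableSpace] …`)
  exact @constantTermVanishes_of_forall_pseudoEisenstein_sq _ _ _ _ _ _ _ _ _ _ hQ (cmParabolicData L 2) i _ μ _ _ _ μN _ _ _ haar _
    (isInvInvariant_cmParabolicData_two L i haar) hcpt ψ hψ horth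

/-- **THE CUSPIDALITY CRITERION FOR `U(Φ₂)` ON THE SQUARE-INTEGRABLE TEST CLASS, UNCONDITIONAL**: a CONTINUOUS square-integrable `ψ` orthogonal, for every index `i`, to every
`θ_Φ` with `Φ ∈ 𝒯_i` IS A CUSP FORM (`ψ ∈` ★ `cmCuspForms L 2 μ`) and `[ψ] ∈` ★ `cmCuspidalSubspace L 2 μ`. [cite: MoeglinWaldspurger1995, II.1.3] [cite: BorelJacquet1979, §4.4, §4.6] -/
theorem mem_cmCuspForms_two_of_forall_pseudoEisenstein_sq {ψ : (cmDatum L 2 (Matrix.of fun i j : Fin 2 => if i.val + j.val + 1 = 2 then (1 : L) else 0)).automorphicQuotient → ℂ}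
    (hψ : Continuous ψ) (hψ2 : MemLp ψ 2 μ)
    (horth : ∀ (i : (cmParabolicData L 2).ι) (Φ : (cmDatum L 2 (Matrix.of fun i j : Fin 2 => if i.val + j.val + 1 = 2 then (1 : L) else 0)).Adelic → ℂ), Measurable Φ →
      (∀ (g : (cmDatum L 2 (Matrix.of fun i j : Fin 2 => if i.val + j.val + 1 = 2 then (1 : L) else 0)).Adelic) (n : (cmParabolicData L 2).radical i), Φ (g * n) = Φ g) →
      ∫⁻ x, (∑' q : (cmDatum L 2 (Matrix.of fun i j : Fin 2 => if i.val + j.val + 1 = 2 then (1 : L) else 0)).quotientSubgroup ⧸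
          ((cmParabolicData L 2).radical i).subgroupOf (cmDatum L 2 (Matrix.of fun i j : Fin 2 => if i.val + j.val + 1 = 2 then (1 : L) else 0)).quotientSubgroup,
            ‖Φ ((Quotient.out x : (cmDatum L 2 (Matrix.of fun i j : Fin 2 => if i.val + j.val + 1 = 2 then (1 : L) else 0)).Adelic) *
              (q.out : (cmDatum L 2 (Matrix.of fun i j : Fin 2 => if i.val + j.val + 1 = 2 then (1 : L) else 0)).Adelic))‖ₑ) ^ 2 ∂μ < ∞ →
      ∫ x, (∑' q : (cmDatum L 2 (Matrix.of fun i j : Fin 2 => if i.val + j.val + 1 = 2 then (1 : L) else 0)).quotientSubgroup ⧸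
          ((cmParabolicData L 2).radical i).subgroupOf (cmDatum L 2 (Matrix.of fun i j : Fin 2 => if i.val + j.val + 1 = 2 then (1 : L) else 0)).quotientSubgroup,
            Φ ((Quotient.out x : (cmDatum L 2 (Matrix.of fun i j : Fin 2 => if i.val + j.val + 1 = 2 then (1 : L) else 0)).Adelic) *
              (q.out : (cmDatum L 2 (Matrix.of fun i j : Fin 2 => if i.val + j.val + 1 = 2 then (1 : L) else 0)).Adelic))) * conj (ψ x) ∂μ = 0) :
    ψ ∈ cmCuspForms L 2 μ ∧ hψ2.toLp ψ ∈ cmCuspidalSubspace L 2 μ :=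
  have h : ψ ∈ cmCuspForms L 2 μ := ⟨hψ, hψ2, fun i => constantTermVanishes_cmParabolicData_two_of_forall_pseudoEisenstein_sq L μ i hψ (horth i)⟩
  ⟨h, AdelicGroupData.toLp_mem_cuspidalSubspace h⟩

/-- **THE DENSITY FOR `U(Φ₂)`, UNCONDITIONAL: `(L²_cusp(U(Φ₂)))ᗮ = closure (span {[θ_Φ] : i, Φ ∈ 𝒯_i})`** — the square-integrable pseudo-Eisenstein series along the
Siegel radical are DENSE in the orthogonal complement of ★ `cmCuspidalSubspace L 2 μ`, for every automorphic `μ`; `𝒯_i` = Borel right-`N_i(𝔸)`-invariant `Φ` with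
`∫⁻ θ_{‖Φ‖}² dμ < ∞` (the `MemLp` witness `hθ` in the set is for instance-free display; any two give the same class).  ★ (p02 g5)
`cuspidalSubspace_orthogonal_eq_topologicalClosure_span_of_cocompact` with the per-radical families supplied by ★ p857132 and ★ p856995.
[cite: MoeglinWaldspurger1995, II.1.2–II.1.4] [cite: Garrett2018, §1.8] [cite: BorelJacquet1979, §4.6] -/
theorem cmCuspidalSubspace_orthogonal_eq_topologicalClosure_span_two :
    ((cmCuspidalSubspace L 2 μ).toSubmodule)ᗮ =
      (Submodule.span ℂ {f : (cmDatum L 2 (Matrix.of fun i j : Fin 2 => if i.val + j.val + 1 = 2 then (1 : L) else 0)).L2 μ |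
        ∃ (i : (cmParabolicData L 2).ι) (Φ : (cmDatum L 2 (Matrix.of fun i j : Fin 2 => if i.val + j.val + 1 = 2 then (1 : L) else 0)).Adelic → ℂ) (_ : Measurable Φ)
          (_ : ∀ (g : (cmDatum L 2 (Matrix.of fun i j : Fin 2 => if i.val + j.val + 1 = 2 then (1 : L) else 0)).Adelic) (n : (cmParabolicData L 2).radical i), Φ (g * n) = Φ g)
          (_ : ∫⁻ x, (∑' q : (cmDatum L 2 (Matrix.of fun i j : Fin 2 => if i.val + j.val + 1 = 2 then (1 : L) else 0)).quotientSubgroup ⧸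
              ((cmParabolicData L 2).radical i).subgroupOf (cmDatum L 2 (Matrix.of fun i j : Fin 2 => if i.val + j.val + 1 = 2 then (1 : L) else 0)).quotientSubgroup,
                ‖Φ ((Quotient.out x : (cmDatum L 2 (Matrix.of fun i j : Fin 2 => if i.val + j.val + 1 = 2 then (1 : L) else 0)).Adelic) *
                  (q.out : (cmDatum L 2 (Matrix.of fun i j : Fin 2 => if i.val + j.val + 1 = 2 then (1 : L) else 0)).Adelic))‖ₑ) ^ 2 ∂μ < ∞)
          (hθ : MemLp (fun x : (cmDatum L 2 (Matrix.of fun i j : Fin 2 => if i.val + j.val + 1 = 2 then (1 : L) else 0)).automorphicQuotient =>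
              ∑' q : (cmDatum L 2 (Matrix.of fun i j : Fin 2 => if i.val + j.val + 1 = 2 then (1 : L) else 0)).quotientSubgroup ⧸
                ((cmParabolicData L 2).radical i).subgroupOf (cmDatum L 2 (Matrix.of fun i j : Fin 2 => if i.val + j.val + 1 = 2 then (1 : L) else 0)).quotientSubgroup,
                  Φ ((Quotient.out x : (cmDatum L 2 (Matrix.of fun i j : Fin 2 => if i.val + j.val + 1 = 2 then (1 : L) else 0)).Adelic) *
                    (q.out : (cmDatum L 2 (Matrix.of fun i j : Fin 2 => if i.val + j.val + 1 = 2 then (1 : L) else 0)).Adelic))) 2 μ),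
          f = hθ.toLp _}).topologicalClosure := by
  haveI := discreteTopology_cmDatum_quotientSubgroup L 2 (Matrix.of fun i j : Fin 2 => if i.val + j.val + 1 = 2 then (1 : L) else 0)
  haveI : ∀ i, IsClosed (((cmParabolicData L 2).radical i : Subgroup (cmDatum L 2 (Matrix.of fun i j : Fin 2 => if i.val + j.val + 1 = 2 then (1 : L) else 0)).Adelic) :
      Set (cmDatum L 2 (Matrix.of fun i j : Fin 2 => if i.val + j.val + 1 = 2 then (1 : L) else 0)).Adelic) := fun i => isClosed_cmParabolicData_radical_two L i
  haveI : ∀ i, LocallyCompactSpace ((cmParabolicData L 2).radical i) := fun i => (isClosed_cmParabolicData_radical_two L i).locallyCompactSpace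
  haveI : ∀ i, SecondCountableTopology ((cmParabolicData L 2).radical i) := fun i => TopologicalSpace.Subtype.secondCountableTopology _
  letI : ∀ i, MeasurableSpace ((cmDatum L 2 (Matrix.of fun i j : Fin 2 => if i.val + j.val + 1 = 2 then (1 : L) else 0)).Adelic ⧸ (cmParabolicData L 2).radical i) := fun i => borel _
  haveI : ∀ i, BorelSpace ((cmDatum L 2 (Matrix.of fun i j : Fin 2 => if i.val + j.val + 1 = 2 then (1 : L) else 0)).Adelic ⧸ (cmParabolicData L 2).radical i) := fun i => ⟨rfl⟩
  have hμN := fun i => exists_invariantMeasure_quotient_cmParabolicData_two L i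
  choose μN hμN hμNc hμNo using hμN
  haveI := hμN; haveI := hμNc; haveI := hμNo
  obtain ⟨νN, hνN⟩ : ∃ νN : ∀ i, Measure ((cmParabolicData L 2).radical i), ∀ i, IsHaarMeasure (νN i) ∧ (νN i).IsInvInvariant :=
    ⟨fun i => haar, fun i => ⟨inferInstance, isInvInvariant_cmParabolicData_two L i haar⟩⟩
  haveI : ∀ i, IsHaarMeasure (νN i) := fun i => (hνN i).1
  haveI : ∀ i, (νN i).IsInvInvariant := fun i => (hνN i).2
  haveI : ∀ i, SigmaFinite (νN i) := fun i => by infer_instance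
  have hcpt : ∀ i : (cmParabolicData L 2).ι, ∃ C : Set ((cmParabolicData L 2).radical i), IsCompact C ∧ ∀ u : (cmParabolicData L 2).radical i, ∃ l : (cmParabolicData L 2).rational i, l • u ∈ C := by
    intro i
    obtain ⟨k, hk⟩ := i
    obtain rfl : k = 1 := by omega
    exact exists_isCompact_rational_smul_mem_siegel L (antidiagOne_eq_over (L := L) (N := 2)).symm
  have h𝓕 := fun i => exists_isFundamentalDomain_cmParabolicData_two L i (νN i)
  choose 𝓕 h𝓕 _h𝓕 using h𝓕
  have hQ : (cmDatum L 2 (Matrix.of fun i j : Fin 2 => if i.val + j.val + 1 = 2 then (1 : L) else 0)).quotientSubgroup =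
      (cmDatum L 2 (Matrix.of fun i j : Fin 2 => if i.val + j.val + 1 = 2 then (1 : L) else 0)).arithmeticSubgroup :=
    (cmDatum_quotientSubgroup L 2 _).trans (cmDatum_arithmeticSubgroup L 2 _).symm
  have key := cuspidalSubspace_orthogonal_eq_topologicalClosure_span_of_cocompact _ hQ (cmParabolicData L 2) μ μN νN hcpt h𝓕
  refine key.trans ?_
  congr 2
  ext f
  constructor
  · rintro ⟨i, Φ, hΦm, hΦ, h2, rfl⟩
    exact ⟨i, Φ, hΦm, hΦ, h2, memLp_two_pseudoEisenstein_automorphicQuotient _ (cmParabolicData L 2) i μ hΦm hΦ h2, rfl⟩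
  · rintro ⟨i, Φ, hΦm, hΦ, h2, hθ, rfl⟩
    exact ⟨i, Φ, hΦm, hΦ, h2, rfl⟩

end DensityTwo

/-! ## `U(Φ₃)` (Heisenberg radical, `𝔓 = cmParabolicDataR L 3`) -/

section DensityThree
variable [MeasurableSpace (cmDatum L 3 (Matrix.of fun i j : Fin 3 => if i.val + j.val + 1 = 3 then (1 : L) else 0)).Adelic] [BorelSpace (cmDatum L 3 (Matrix.of fun i j : Fin 3 => if i.val + j.val + 1 = 3 then (1 : L) else 0)).Adelic]
  (μ : Measure (cmDatum L 3 (Matrix.of fun i j : Fin 3 => if i.val + j.val + 1 = 3 then (1 : L) else 0)).automorphicQuotient) [(cmDatum L 3 (Matrix.of fun i j : Fin 3 => if i.val + j.val + 1 = 3 then (1 : L) else 0)).IsAutomorphicMeasure μ]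

/-- **F3-c FOR `U(Φ₃)`, UNCONDITIONAL**: for an automorphic `μ` on `X = U(Φ₃)(L⁺)\U(Φ₃)(𝔸_{L⁺})`, a CONTINUOUS `ψ : X → ℂ` and an index `i`, if `∫_X θ_Φ · conj ψ dμ = 0` for
every Borel right-`N_i(𝔸)`-invariant `Φ` with `∫⁻_X θ_{‖Φ‖}² dμ < ∞` (the SQUARE-INTEGRABLE test class `𝒯_i`), then ★ `ConstantTermVanishes (cmParabolicDataR L 3) ψ i` — ★ (p02 g5)
`constantTermVanishes_of_forall_pseudoEisenstein_sq` with all per-radical data supplied by ★ p857132 (`exists_invariantMeasure_quotient_cmParabolicDataR_three`, `isInvInvariant_cmParabolicDataR_three`, ★ `exists_isCompact_rational_smul_mem_heisenberg`).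
[cite: MoeglinWaldspurger1995, II.1.3] [cite: BorelJacquet1979, §4.4] -/
theorem constantTermVanishes_cmParabolicDataR_three_of_forall_pseudoEisenstein_sq (i : (cmParabolicDataR L 3).ι)
    {ψ : (cmDatum L 3 (Matrix.of fun i j : Fin 3 => if i.val + j.val + 1 = 3 then (1 : L) else 0)).automorphicQuotient → ℂ} (hψ : Continuous ψ)
    (horth : ∀ Φ : (cmDatum L 3 (Matrix.of fun i j : Fin 3 => if i.val + j.val + 1 = 3 then (1 : L) else 0)).Adelic → ℂ, Measurable Φ →
      (∀ (g : (cmDatum L 3 (Matrix.of fun i j : Fin 3 => if i.val + j.val + 1 = 3 then (1 : L) else 0)).Adelic) (n : (cmParabolicDataR L 3).radical i), Φ (g * n) = Φ g) →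
      ∫⁻ x, (∑' q : (cmDatum L 3 (Matrix.of fun i j : Fin 3 => if i.val + j.val + 1 = 3 then (1 : L) else 0)).quotientSubgroup ⧸
          ((cmParabolicDataR L 3).radical i).subgroupOf (cmDatum L 3 (Matrix.of fun i j : Fin 3 => if i.val + j.val + 1 = 3 then (1 : L) else 0)).quotientSubgroup,
            ‖Φ ((Quotient.out x : (cmDatum L 3 (Matrix.of fun i j : Fin 3 => if i.val + j.val + 1 = 3 then (1 : L) else 0)).Adelic) *
              (q.out : (cmDatum L 3 (Matrix.of fun i j : Fin 3 => if i.val + j.val + 1 = 3 then (1 : L) else 0)).Adelic))‖ₑ) ^ 2 ∂μ < ∞ →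
      ∫ x, (∑' q : (cmDatum L 3 (Matrix.of fun i j : Fin 3 => if i.val + j.val + 1 = 3 then (1 : L) else 0)).quotientSubgroup ⧸
          ((cmParabolicDataR L 3).radical i).subgroupOf (cmDatum L 3 (Matrix.of fun i j : Fin 3 => if i.val + j.val + 1 = 3 then (1 : L) else 0)).quotientSubgroup,
            Φ ((Quotient.out x : (cmDatum L 3 (Matrix.of fun i j : Fin 3 => if i.val + j.val + 1 = 3 then (1 : L) else 0)).Adelic) *
              (q.out : (cmDatum L 3 (Matrix.of fun i j : Fin 3 => if i.val + j.val + 1 = 3 then (1 : L) else 0)).Adelic))) * conj (ψ x) ∂μ = 0) :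
    AdelicGroupData.ConstantTermVanishes (cmParabolicDataR L 3) ψ i := by
  haveI := discreteTopology_cmDatum_quotientSubgroup L 3 (Matrix.of fun i j : Fin 3 => if i.val + j.val + 1 = 3 then (1 : L) else 0)
  haveI : IsClosed (((cmParabolicDataR L 3).radical i : Subgroup (cmDatum L 3 (Matrix.of fun i j : Fin 3 => if i.val + j.val + 1 = 3 then (1 : L) else 0)).Adelic) :
      Set (cmDatum L 3 (Matrix.of fun i j : Fin 3 => if i.val + j.val + 1 = 3 then (1 : L) else 0)).Adelic) := isClosed_cmParabolicDataR_radical_three L i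
  haveI : LocallyCompactSpace ((cmParabolicDataR L 3).radical i) := (isClosed_cmParabolicDataR_radical_three L i).locallyCompactSpace
  letI : MeasurableSpace ((cmDatum L 3 (Matrix.of fun i j : Fin 3 => if i.val + j.val + 1 = 3 then (1 : L) else 0)).Adelic ⧸ (cmParabolicDataR L 3).radical i) := borel _
  haveI : BorelSpace ((cmDatum L 3 (Matrix.of fun i j : Fin 3 => if i.val + j.val + 1 = 3 then (1 : L) else 0)).Adelic ⧸ (cmParabolicDataR L 3).radical i) := ⟨rfl⟩
  obtain ⟨μN, hμN, hμNc, hμNo⟩ := exists_invariantMeasure_quotient_cmParabolicDataR_three L i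
  haveI := hμN; haveI := hμNc; haveI := hμNo
  have hcpt : ∃ C : Set ((cmParabolicDataR L 3).radical i), IsCompact C ∧ ∀ u : (cmParabolicDataR L 3).radical i, ∃ l : (cmParabolicDataR L 3).rational i, l • u ∈ C := by
    obtain ⟨k, hk⟩ := i
    obtain rfl : k = 1 := by omega
    exact exists_isCompact_rational_smul_mem_heisenberg L (antidiagOne_eq_over (L := L) (N := 3)).symm
  have hQ : (cmDatum L 3 (Matrix.of fun i j : Fin 3 => if i.val + j.val + 1 = 3 then (1 : L) else 0)).quotientSubgroup =
      (cmDatum L 3 (Matrix.of fun i j : Fin 3 => if i.val + j.val + 1 = 3 then (1 : L) else 0)).arithmeticSubgroup :=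
    (cmDatum_quotientSubgroup L 3 _).trans (cmDatum_arithmeticSubgroup L 3 _).symm
  -- ★ F3-c at the subtype Borel structure and `ν_N := haar` (explicit mode: the conclusion is itself a `∀ [MeasurableSpace] …`)
  exact @constantTermVanishes_of_forall_pseudoEisenstein_sq _ _ _ _ _ _ _ _ _ _ hQ (cmParabolicDataR L 3) i _ μ _ _ _ μN _ _ _ haar _
    (isInvInvariant_cmParabolicDataR_three L i haar) hcpt ψ hψ horth

/-- **THE CUSPIDALITY CRITERION FOR `U(Φ₃)` ON THE SQUARE-INTEGRABLE TEST CLASS, UNCONDITIONAL**: a CONTINUOUS square-integrable `ψ` orthogonal, for every index `i`, to every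
`θ_Φ` with `Φ ∈ 𝒯_i` IS A CUSP FORM (`ψ ∈` ★ `cmCuspFormsR L 3 μ`) and `[ψ] ∈` ★ `cmCuspidalSubspaceR L 3 μ`. [cite: MoeglinWaldspurger1995, II.1.3] [cite: BorelJacquet1979, §4.4, §4.6] -/
theorem mem_cmCuspFormsR_three_of_forall_pseudoEisenstein_sq {ψ : (cmDatum L 3 (Matrix.of fun i j : Fin 3 => if i.val + j.val + 1 = 3 then (1 : L) else 0)).automorphicQuotient → ℂ}
    (hψ : Continuous ψ) (hψ2 : MemLp ψ 2 μ)
    (horth : ∀ (i : (cmParabolicDataR L 3).ι) (Φ : (cmDatum L 3 (Matrix.of fun i j : Fin 3 => if i.val + j.val + 1 = 3 then (1 : L) else 0)).Adelic → ℂ), Measurable Φ →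
      (∀ (g : (cmDatum L 3 (Matrix.of fun i j : Fin 3 => if i.val + j.val + 1 = 3 then (1 : L) else 0)).Adelic) (n : (cmParabolicDataR L 3).radical i), Φ (g * n) = Φ g) →
      ∫⁻ x, (∑' q : (cmDatum L 3 (Matrix.of fun i j : Fin 3 => if i.val + j.val + 1 = 3 then (1 : L) else 0)).quotientSubgroup ⧸
          ((cmParabolicDataR L 3).radical i).subgroupOf (cmDatum L 3 (Matrix.of fun i j : Fin 3 => if i.val + j.val + 1 = 3 then (1 : L) else 0)).quotientSubgroup,
            ‖Φ ((Quotient.out x : (cmDatum L 3 (Matrix.of fun i j : Fin 3 => if i.val + j.val + 1 = 3 then (1 : L) else 0)).Adelic) *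
              (q.out : (cmDatum L 3 (Matrix.of fun i j : Fin 3 => if i.val + j.val + 1 = 3 then (1 : L) else 0)).Adelic))‖ₑ) ^ 2 ∂μ < ∞ →
      ∫ x, (∑' q : (cmDatum L 3 (Matrix.of fun i j : Fin 3 => if i.val + j.val + 1 = 3 then (1 : L) else 0)).quotientSubgroup ⧸
          ((cmParabolicDataR L 3).radical i).subgroupOf (cmDatum L 3 (Matrix.of fun i j : Fin 3 => if i.val + j.val + 1 = 3 then (1 : L) else 0)).quotientSubgroup,
            Φ ((Quotient.out x : (cmDatum L 3 (Matrix.of fun i j : Fin 3 => if i.val + j.val + 1 = 3 then (1 : L) else 0)).Adelic) *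
              (q.out : (cmDatum L 3 (Matrix.of fun i j : Fin 3 => if i.val + j.val + 1 = 3 then (1 : L) else 0)).Adelic))) * conj (ψ x) ∂μ = 0) :
    ψ ∈ cmCuspFormsR L 3 μ ∧ hψ2.toLp ψ ∈ cmCuspidalSubspaceR L 3 μ :=
  have h : ψ ∈ cmCuspFormsR L 3 μ := ⟨hψ, hψ2, fun i => constantTermVanishes_cmParabolicDataR_three_of_forall_pseudoEisenstein_sq L μ i hψ (horth i)⟩
  ⟨h, AdelicGroupData.toLp_mem_cuspidalSubspace h⟩

/-- **THE DENSITY FOR `U(Φ₃)`, UNCONDITIONAL: `(L²_cusp(U(Φ₃)))ᗮ = closure (span {[θ_Φ] : i, Φ ∈ 𝒯_i})`** — the square-integrable pseudo-Eisenstein series along the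
Heisenberg radical are DENSE in the orthogonal complement of ★ `cmCuspidalSubspaceR L 3 μ`, for every automorphic `μ`; `𝒯_i` = Borel right-`N_i(𝔸)`-invariant `Φ` with
`∫⁻ θ_{‖Φ‖}² dμ < ∞` (the `MemLp` witness `hθ` in the set is for instance-free display; any two give the same class).  ★ (p02 g5)
`cuspidalSubspace_orthogonal_eq_topologicalClosure_span_of_cocompact` with the per-radical families supplied by ★ p857132 and ★ p856995.
[cite: MoeglinWaldspurger1995, II.1.2–II.1.4] [cite: Garrett2018, §1.8] [cite: BorelJacquet1979, §4.6] -/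
theorem cmCuspidalSubspaceR_orthogonal_eq_topologicalClosure_span_three :
    ((cmCuspidalSubspaceR L 3 μ).toSubmodule)ᗮ =
      (Submodule.span ℂ {f : (cmDatum L 3 (Matrix.of fun i j : Fin 3 => if i.val + j.val + 1 = 3 then (1 : L) else 0)).L2 μ |
        ∃ (i : (cmParabolicDataR L 3).ι) (Φ : (cmDatum L 3 (Matrix.of fun i j : Fin 3 => if i.val + j.val + 1 = 3 then (1 : L) else 0)).Adelic → ℂ) (_ : Measurable Φ)
          (_ : ∀ (g : (cmDatum L 3 (Matrix.of fun i j : Fin 3 => if i.val + j.val + 1 = 3 then (1 : L) else 0)).Adelic) (n : (cmParabolicDataR L 3).radical i), Φ (g * n) = Φ g)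
          (_ : ∫⁻ x, (∑' q : (cmDatum L 3 (Matrix.of fun i j : Fin 3 => if i.val + j.val + 1 = 3 then (1 : L) else 0)).quotientSubgroup ⧸
              ((cmParabolicDataR L 3).radical i).subgroupOf (cmDatum L 3 (Matrix.of fun i j : Fin 3 => if i.val + j.val + 1 = 3 then (1 : L) else 0)).quotientSubgroup,
                ‖Φ ((Quotient.out x : (cmDatum L 3 (Matrix.of fun i j : Fin 3 => if i.val + j.val + 1 = 3 then (1 : L) else 0)).Adelic) *
                  (q.out : (cmDatum L 3 (Matrix.of fun i j : Fin 3 => if i.val + j.val + 1 = 3 then (1 : L) else 0)).Adelic))‖ₑ) ^ 2 ∂μ < ∞)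
          (hθ : MemLp (fun x : (cmDatum L 3 (Matrix.of fun i j : Fin 3 => if i.val + j.val + 1 = 3 then (1 : L) else 0)).automorphicQuotient =>
              ∑' q : (cmDatum L 3 (Matrix.of fun i j : Fin 3 => if i.val + j.val + 1 = 3 then (1 : L) else 0)).quotientSubgroup ⧸
                ((cmParabolicDataR L 3).radical i).subgroupOf (cmDatum L 3 (Matrix.of fun i j : Fin 3 => if i.val + j.val + 1 = 3 then (1 : L) else 0)).quotientSubgroup,
                  Φ ((Quotient.out x : (cmDatum L 3 (Matrix.of fun i j : Fin 3 => if i.val + j.val + 1 = 3 then (1 : L) else 0)).Adelic) *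
                    (q.out : (cmDatum L 3 (Matrix.of fun i j : Fin 3 => if i.val + j.val + 1 = 3 then (1 : L) else 0)).Adelic))) 2 μ),
          f = hθ.toLp _}).topologicalClosure := by
  haveI := discreteTopology_cmDatum_quotientSubgroup L 3 (Matrix.of fun i j : Fin 3 => if i.val + j.val + 1 = 3 then (1 : L) else 0)
  haveI : ∀ i, IsClosed (((cmParabolicDataR L 3).radical i : Subgroup (cmDatum L 3 (Matrix.of fun i j : Fin 3 => if i.val + j.val + 1 = 3 then (1 : L) else 0)).Adelic) :
      Set (cmDatum L 3 (Matrix.of fun i j : Fin 3 => if i.val + j.val + 1 = 3 then (1 : L) else 0)).Adelic) := fun i => isClosed_cmParabolicDataR_radical_three L i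
  haveI : ∀ i, LocallyCompactSpace ((cmParabolicDataR L 3).radical i) := fun i => (isClosed_cmParabolicDataR_radical_three L i).locallyCompactSpace
  haveI : ∀ i, SecondCountableTopology ((cmParabolicDataR L 3).radical i) := fun i => TopologicalSpace.Subtype.secondCountableTopology _
  letI : ∀ i, MeasurableSpace ((cmDatum L 3 (Matrix.of fun i j : Fin 3 => if i.val + j.val + 1 = 3 then (1 : L) else 0)).Adelic ⧸ (cmParabolicDataR L 3).radical i) := fun i => borel _
  haveI : ∀ i, BorelSpace ((cmDatum L 3 (Matrix.of fun i j : Fin 3 => if i.val + j.val + 1 = 3 then (1 : L) else 0)).Adelic ⧸ (cmParabolicDataR L 3).radical i) := fun i => ⟨rfl⟩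
  have hμN := fun i => exists_invariantMeasure_quotient_cmParabolicDataR_three L i
  choose μN hμN hμNc hμNo using hμN
  haveI := hμN; haveI := hμNc; haveI := hμNo
  obtain ⟨νN, hνN⟩ : ∃ νN : ∀ i, Measure ((cmParabolicDataR L 3).radical i), ∀ i, IsHaarMeasure (νN i) ∧ (νN i).IsInvInvariant :=
    ⟨fun i => haar, fun i => ⟨inferInstance, isInvInvariant_cmParabolicDataR_three L i haar⟩⟩
  haveI : ∀ i, IsHaarMeasure (νN i) := fun i => (hνN i).1
  haveI : ∀ i, (νN i).IsInvInvariant := fun i => (hνN i).2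
  haveI : ∀ i, SigmaFinite (νN i) := fun i => by infer_instance
  have hcpt : ∀ i : (cmParabolicDataR L 3).ι, ∃ C : Set ((cmParabolicDataR L 3).radical i), IsCompact C ∧ ∀ u : (cmParabolicDataR L 3).radical i, ∃ l : (cmParabolicDataR L 3).rational i, l • u ∈ C := by
    intro i
    obtain ⟨k, hk⟩ := i
    obtain rfl : k = 1 := by omega
    exact exists_isCompact_rational_smul_mem_heisenberg L (antidiagOne_eq_over (L := L) (N := 3)).symm
  have h𝓕 := fun i => exists_isFundamentalDomain_cmParabolicDataR_three L i (νN i)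
  choose 𝓕 h𝓕 _h𝓕 using h𝓕
  have hQ : (cmDatum L 3 (Matrix.of fun i j : Fin 3 => if i.val + j.val + 1 = 3 then (1 : L) else 0)).quotientSubgroup =
      (cmDatum L 3 (Matrix.of fun i j : Fin 3 => if i.val + j.val + 1 = 3 then (1 : L) else 0)).arithmeticSubgroup :=
    (cmDatum_quotientSubgroup L 3 _).trans (cmDatum_arithmeticSubgroup L 3 _).symm
  have key := cuspidalSubspace_orthogonal_eq_topologicalClosure_span_of_cocompact _ hQ (cmParabolicDataR L 3) μ μN νN hcpt h𝓕
  refine key.trans ?_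
  congr 2
  ext f
  constructor
  · rintro ⟨i, Φ, hΦm, hΦ, h2, rfl⟩
    exact ⟨i, Φ, hΦm, hΦ, h2, memLp_two_pseudoEisenstein_automorphicQuotient _ (cmParabolicDataR L 3) i μ hΦm hΦ h2, rfl⟩
  · rintro ⟨i, Φ, hΦm, hΦ, h2, hθ, rfl⟩
    exact ⟨i, Φ, hΦm, hΦ, h2, rfl⟩

end DensityThree

end Summit.HodgeConjecture.HodgeConjecture.Cruxes.H413.K2E1PseudoEisensteinDensityU

end
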